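import Summits.CriticalPhenomena.PercolationContinuityZ3.Theorems.FK.IsingEnergyCLT
import Summits.CriticalPhenomena.PercolationContinuityZ3.Theorems.FK.IsingJointCLT
import Literature.Probability.LatticeModels.CriticalGibbsUniqueness
import HarnessLib

/-!
# NEWMAN'S CLT FOR THE (UNIQUE) ISING GIBBS STATE BELOW `β_c`: FOR EVERY `μ ∈ 𝒢(β, 0)`, `0 ≤ β < β_c(d)`, `d ≥ 2` —
# MAGNETISATION, ENERGY, EVERY LOCAL OBSERVABLE, AND JOINTLY

Claimed R42 (8)(c) in the cell INBOX at 2026-08-28T18:14:08Z by fkp-10a gen 355 (NEW CLAIM #2 of the gen), addressed to coordinator fk-4 (next seated gen; (ι) in force for windows); lineage row FO-10a-g355l (self-suggested), package g355-isinglocal, label IM-H.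
Helper file of the `fk-continuity` build cell (bschramm lane; `--supports stmt-CriticalPhenomena-4575`); builds on
p205010 (kernel theorem, internal audit signed; external expert review pending). No definitions, no named facts, no
sorries; standard axioms. UNCONDITIONAL.

The companion files state the central limit theorems for "the free state", i.e. under the hypothesis
`∀ A, ∫ σ_A dμ = freeCorr d β 0 A`. Below `β_c` the Ising specification at zero field has EXACTLY ONE Gibbs measure
(Lebowitz–Martin-Löf 1972; Friedli–Velenik 2017, Thm. 3.28 — the tree's PROVED
`hasUniqueGibbsMeasure_of_lt_criticalBeta_holds`), which is the free state (`exists_freeMeasure_holds`), so that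
hypothesis is discharged by mere membership `μ ∈ isingGibbsMeasures d β 0` (the DLR equations). This file records the
resulting hypothesis-free statements — Ellis 2006, Thm. V.7.2 (a) for `(β, 0) ∈ 𝒰`, `β < β_c`, with respect to THE
infinite-volume Gibbs state `P_{β,0}`:

* `spinCorr_eq_freeCorr_of_lt_criticalBeta` — every `μ ∈ 𝒢(β,0)`, `β < β_c`, has the free correlations;
* **`tendstoInDistribution_magnetization_of_mem_isingGibbsMeasures`** — `M_n/√|Λ_n| ⇒ N(0, χ(β))`, `χ(β) ≥ 1`;
* **`tendstoInDistribution_localObservable_of_mem_isingGibbsMeasures`** — every local observable;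
* **`tendstoInDistribution_energy_of_mem_isingGibbsMeasures`** — the energy `Σ_{z∈Λ_n}Σ_i σ_zσ_{z+e_i}`;
* **`tendstoInDistribution_localObservables_joint_of_mem_isingGibbsMeasures`** — finitely many local observables jointly,
  `N(0, Σ)` on `ℝ^κ`;
* `isingGibbsMeasures_nonempty_of_nonneg` — non-vacuity (`𝒢(β,0) ≠ ∅`).

## References

* R. S. Ellis, *Entropy, Large Deviations, and Statistical Mechanics*, Springer 2006, §V.7, Thm. V.7.2. [Ellis2006]
* C. M. Newman, Comm. Math. Phys. 74 (1980) 119–128, Thm. 2. [Newman1980]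
* S. Friedli, Y. Velenik, *Statistical Mechanics of Lattice Systems*, CUP 2017, Thm. 3.28 (uniqueness iff `m* = 0`),
  Thm. 6.26. [FriedliVelenik2017]
* J. L. Lebowitz, A. Martin-Löf, Comm. Math. Phys. 25 (1972) 276–282.
-/

noncomputable section

namespace Summit.CriticalPhenomena.PercolationContinuityZ3.Theorems.FK

namespace IsingCLT

open MeasureTheory ProbabilityTheory Filter Topology Finset Matrix
open Literature.Probability.Percolation Literature.Probability.LatticeModels
open Summit.CriticalPhenomena.PercolationContinuityZ3.Theorems.FK.NewmanCLT

variable {d : ℕ}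

/-- **Below `β_c` every Ising Gibbs measure is the free state** (uniqueness, Friedli–Velenik 2017, Thm. 3.28 — the
tree's `hasUniqueGibbsMeasure_of_lt_criticalBeta_holds` — and `exists_freeMeasure_holds`): for `d ≥ 2`,
`0 ≤ β < β_c(d)` and `μ ∈ 𝒢(β, 0)`, `∫ σ_A dμ = ⟨σ_A⟩^∅_{β,0}` for every finite `A`.
[cite: FriedliVelenik2017, Thm. 3.28 and Thm. 6.26] -/
theorem spinCorr_eq_freeCorr_of_lt_criticalBeta (hd : 2 ≤ d) {β : ℝ} (hβ : 0 ≤ β) (hβc : β < criticalBeta d)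
    {μ : Measure (SpinConfig (Site d))} (hμ : μ ∈ isingGibbsMeasures d β 0) (A : Finset (Site d)) :
    spinCorr μ A = freeCorr d β 0 A := by
  obtain ⟨μf, hμf, -, hcorr⟩ := exists_freeMeasure_holds d (β := β) 0 hβ le_rfl
  rw [(hasUniqueGibbsMeasure_of_lt_criticalBeta_holds (d := d) (β := β) hd hβ hβc).1 hμ hμf]
  exact hcorr A

/-- A Gibbs measure is a probability measure. [cite: FriedliVelenik2017, Def. 6.13] -/
theorem isProbabilityMeasure_of_mem_isingGibbsMeasures {β h : ℝ} {μ : Measure (SpinConfig (Site d))}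
    (hμ : μ ∈ isingGibbsMeasures d β h) : IsProbabilityMeasure μ :=
  ((mem_isingGibbsMeasures_iff d β h μ).1 hμ).isProbabilityMeasure

/-- **Non-vacuity**: `𝒢(β, 0) ≠ ∅` (the free state belongs to it). [cite: FriedliVelenik2017, Thm. 6.26] -/
theorem isingGibbsMeasures_nonempty_of_nonneg {β : ℝ} (hβ : 0 ≤ β) : (isingGibbsMeasures d β 0).Nonempty := by
  obtain ⟨μf, hμf, -, -⟩ := exists_freeMeasure_holds d (β := β) 0 hβ le_rfl
  exact ⟨μf, hμf⟩

/-! ### The central limit theorems for THE Gibbs state below `β_c` -/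

/-- **CLT FOR THE ISING MAGNETISATION UNDER THE (UNIQUE) GIBBS STATE BELOW `β_c`** (Ellis 2006, Thm. V.7.2 (a) at
`(β,0)`, `β < β_c`; Newman 1980, Thm. 2): for `d ≥ 2`, `0 ≤ β < β_c(d)` and EVERY `μ ∈ 𝒢(β,0)` (the set of
infinite-volume Ising Gibbs measures — a singleton here), `M_n/√|Λ_n| → N(0, χ(β))` in distribution,
`χ(β) = Σ_x ⟨σ_0σ_x⟩_β = (susceptibility d β).toReal ≥ 1`. [cite: Ellis2006, Thm. V.7.2; Newman1980, Thm. 2; FriedliVelenik2017, Thm. 3.28] -/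
theorem tendstoInDistribution_magnetization_of_mem_isingGibbsMeasures {Ω' : Type*} {mΩ' : MeasurableSpace Ω'}
    {P' : Measure Ω'} [IsProbabilityMeasure P'] {Y : Ω' → ℝ} (hd : 2 ≤ d) {β : ℝ} (hβ : 0 ≤ β)
    (hβc : β < criticalBeta d) {μ : Measure (SpinConfig (Site d))} (hμ : μ ∈ isingGibbsMeasures d β 0)
    (hY : HasLaw Y (gaussianReal 0 (susceptibility d β).toNNReal) P') :
    haveI := isProbabilityMeasure_of_mem_isingGibbsMeasures hμ
    TendstoInDistribution (fun (n : ℕ) (σ : SpinConfig (Site d)) =>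
        (Real.sqrt #(box d n))⁻¹ * ∑ z ∈ box d n, spinAt z σ) atTop Y (fun _ => μ) P' := by
  haveI := isProbabilityMeasure_of_mem_isingGibbsMeasures hμ
  exact tendstoInDistribution_magnetization_of_lt_criticalBeta hd hβ hβc μ
    (spinCorr_eq_freeCorr_of_lt_criticalBeta hd hβ hβc hμ) hY

/-- **CLT FOR EVERY LOCAL OBSERVABLE UNDER THE GIBBS STATE BELOW `β_c`**: for `d ≥ 2`, `0 ≤ β < β_c(d)`, every
`μ ∈ 𝒢(β,0)` and every `f` depending on finitely many spins,
`|Λ_n|^{-1/2} Σ_{z∈Λ_n} (f∘θ_{−z} − E_μ f) ⇒ N(0, Σ_z Cov_μ(f, f∘θ_{−z}))`.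
[cite: Newman1980, Thm. 2 and remark after (12); Ellis2006, Thm. V.7.2] -/
theorem tendstoInDistribution_localObservable_of_mem_isingGibbsMeasures {Ω' : Type*} {mΩ' : MeasurableSpace Ω'}
    {P' : Measure Ω'} [IsProbabilityMeasure P'] {Y : Ω' → ℝ} (hd : 2 ≤ d) {β : ℝ} (hβ : 0 ≤ β)
    (hβc : β < criticalBeta d) {μ : Measure (SpinConfig (Site d))} (hμ : μ ∈ isingGibbsMeasures d β 0)
    {f : SpinConfig (Site d) → ℝ} {D : Finset (Site d)} (hf : DependsOn f (↑D : Set (Site d))) {v : NNReal}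
    (hv : (v : ℝ) = ∑' z : Site d, cov[f, fun σ => f (configShift (-z) σ); μ])
    (hY : HasLaw Y (gaussianReal 0 v) P') :
    haveI := isProbabilityMeasure_of_mem_isingGibbsMeasures hμ
    TendstoInDistribution (fun (n : ℕ) (σ : SpinConfig (Site d)) => (Real.sqrt #(box d n))⁻¹ *
        (∑ z ∈ box d n, f (configShift (-z) σ) - #(box d n) * ∫ σ', f σ' ∂μ)) atTop Y (fun _ => μ) P' := by
  haveI := isProbabilityMeasure_of_mem_isingGibbsMeasures hμ
  exact tendstoInDistribution_localObservable_free_of_lt_criticalBeta hd hβ hβc μ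
    (spinCorr_eq_freeCorr_of_lt_criticalBeta hd hβ hβc hμ) hf hv hY

/-- **CLT FOR THE ISING ENERGY UNDER THE GIBBS STATE BELOW `β_c`**: for `d ≥ 2`, `0 ≤ β < β_c(d)` and every
`μ ∈ 𝒢(β,0)`, `(E_n − |Λ_n| Σ_i ⟨σ_0σ_{e_i}⟩_β)/√|Λ_n| ⇒ N(0, σ_E²)`, `E_n = Σ_{z∈Λ_n} Σ_i σ_zσ_{z+e_i}`.
[cite: Newman1980, §1 and Thm. 2; Ellis2006, Thm. V.7.2] -/
theorem tendstoInDistribution_energy_of_mem_isingGibbsMeasures {Ω' : Type*} {mΩ' : MeasurableSpace Ω'}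
    {P' : Measure Ω'} [IsProbabilityMeasure P'] {Y : Ω' → ℝ} (hd : 2 ≤ d) {β : ℝ} (hβ : 0 ≤ β)
    (hβc : β < criticalBeta d) {μ : Measure (SpinConfig (Site d))} (hμ : μ ∈ isingGibbsMeasures d β 0) {v : NNReal}
    (hv : (v : ℝ) = ∑' z : Site d, cov[fun σ => ∑ i : Fin d, spinAt 0 σ * spinAt (Pi.single i 1) σ,
      fun σ => (fun σ : SpinConfig (Site d) => ∑ i : Fin d, spinAt 0 σ * spinAt (Pi.single i 1) σ)
        (configShift (-z) σ); μ])
    (hY : HasLaw Y (gaussianReal 0 v) P') :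
    haveI := isProbabilityMeasure_of_mem_isingGibbsMeasures hμ
    TendstoInDistribution (fun (n : ℕ) (σ : SpinConfig (Site d)) => (Real.sqrt #(box d n))⁻¹ *
        (∑ z ∈ box d n, ∑ i : Fin d, spinAt z σ * spinAt (z + Pi.single i 1) σ -
          #(box d n) * ∑ i : Fin d, twoPointFree d β (Pi.single i 1))) atTop Y (fun _ => μ) P' := by
  haveI := isProbabilityMeasure_of_mem_isingGibbsMeasures hμ
  exact tendstoInDistribution_energy_free_of_lt_criticalBeta hd hβ hβc μ
    (spinCorr_eq_freeCorr_of_lt_criticalBeta hd hβ hβc hμ) hv hY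

/-- **JOINT CLT FOR FINITELY MANY LOCAL OBSERVABLES UNDER THE GIBBS STATE BELOW `β_c`**: for `d ≥ 2`,
`0 ≤ β < β_c(d)`, every `μ ∈ 𝒢(β,0)` and local `f_i` (`i ∈ κ` finite, common window `D`):
`|Λ_n|^{-1/2}(S_n(f_i) − E_μ S_n(f_i))_i ⇒ N(0, Σ)` on `ℝ^κ`, `Σ_{ij} = Σ_z Cov_μ(f_i, f_j∘θ_{−z})`.
[cite: Newman1980, Thm. 2; Ellis2006, Thm. V.7.2] -/
theorem tendstoInDistribution_localObservables_joint_of_mem_isingGibbsMeasures {Ω' : Type*}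
    {mΩ' : MeasurableSpace Ω'} {P' : Measure Ω'} [IsProbabilityMeasure P'] {κ : Type*} [Fintype κ] [DecidableEq κ]
    {Z : Ω' → EuclideanSpace ℝ κ} (hd : 2 ≤ d) {β : ℝ} (hβ : 0 ≤ β) (hβc : β < criticalBeta d)
    {μ : Measure (SpinConfig (Site d))} (hμ : μ ∈ isingGibbsMeasures d β 0) {f : κ → SpinConfig (Site d) → ℝ}
    {D : Finset (Site d)} (hf : ∀ i, DependsOn (f i) (↑D : Set (Site d))) {S : Matrix κ κ ℝ}
    (hS : ∀ i j, S i j = ∑' z : Site d, cov[f i, fun σ => f j (configShift (-z) σ); μ])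
    (hZ : HasLaw Z (multivariateGaussian 0 S) P') :
    haveI := isProbabilityMeasure_of_mem_isingGibbsMeasures hμ
    TendstoInDistribution (fun (n : ℕ) (σ : SpinConfig (Site d)) =>
        (WithLp.toLp 2 fun i : κ => (Real.sqrt #(box d n))⁻¹ *
          (∑ z ∈ box d n, f i (configShift (-z) σ) - ∫ σ', ∑ z ∈ box d n, f i (configShift (-z) σ') ∂μ) :
          EuclideanSpace ℝ κ)) atTop Z (fun _ => μ) P' := by
  haveI := isProbabilityMeasure_of_mem_isingGibbsMeasures hμ
  exact tendstoInDistribution_localObservables_joint_free_of_lt_criticalBeta hd hβ hβc μ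
    (spinCorr_eq_freeCorr_of_lt_criticalBeta hd hβ hβc hμ) hf hS hZ

/-- **The covariance matrix of the joint CLT is positive semidefinite** for every `μ ∈ 𝒢(β,0)`, `β < β_c` (so
`multivariateGaussian 0 Σ` is an honest Gaussian law and `hZ` is instantiable). [cite: Newman1980, Thm. 2 (D)] -/
theorem posSemidef_spinCovMatrix_of_mem_isingGibbsMeasures {κ : Type*} [Fintype κ] (hd : 2 ≤ d) {β : ℝ}
    (hβ : 0 ≤ β) (hβc : β < criticalBeta d) {μ : Measure (SpinConfig (Site d))} (hμ : μ ∈ isingGibbsMeasures d β 0)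
    {f : κ → SpinConfig (Site d) → ℝ} {D : Finset (Site d)} (hf : ∀ i, DependsOn (f i) (↑D : Set (Site d)))
    {S : Matrix κ κ ℝ} (hS : ∀ i j, S i j = ∑' z : Site d, cov[f i, fun σ => f j (configShift (-z) σ); μ]) :
    S.PosSemidef := by
  haveI := isProbabilityMeasure_of_mem_isingGibbsMeasures hμ
  have hc := spinCorr_eq_freeCorr_of_lt_criticalBeta hd hβ hβc hμ
  have hsum : Summable fun z : Site d => cov[spinAt 0, spinAt z; μ] := by
    simp_rw [covariance_spinAt_eq_twoPointFree hβ hc, sub_zero]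
    exact summable_twoPointFree_of_lt_criticalBeta hd hβ hβc
  exact posSemidef_spinCovMatrix (isPositivelyAssociated_of_spinCorr_eq_freeCorr hβ le_rfl μ hc)
    (isTranslationInvariantMeasure_of_spinCorr_eq_freeCorr hβ le_rfl μ hc) hsum hf hS

end IsingCLT

end Summit.CriticalPhenomena.PercolationContinuityZ3.Theorems.FK

end
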